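import Summits.NavierStokesRegularity.FunctionalMining.TopEigGapCutoffLow
import Summits.NavierStokesRegularity.FunctionalMining.TopEigGapCoerciveHigh
import HarnessLib

/-!
# FunctionalMining — L-λ(η) BELOW `q = 2`: the heat side `∫ρ^δ_q ≤ (4/(q(q−1)))T_q` at EVERY level `δ`,
# and the velocity brick `∫‖u‖² ≤ K₀Φ_q^{2/q}` for `6/5 ≤ q ≤ 2`

HONEST FRAMING. Search for candidate a priori estimates; no regularity claim. Cell `pub-nsfunc`, prove
seat (gen 32). Nothing about Navier–Stokes solutions is asserted. Two inputs of `TopEigGapCoerciveBelowTwo`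
(the node `TopEigGapCoercivePos q η` for every real `6/5 ≤ q < 2` on the WHOLE top-gap class, prove
DERIVATIVES §56):
1. **`integral_cutDensityPow_le_heat_of_le_two`**: for `v` smooth and divergence free on `T³` with
   `λ₂ ≤ (1−η)λ₁` (`η > 0`), `1 < q ≤ 2` and EVERY `δ > 0`, the cut-off channel density of the tree
   (`cutDensityPow δ q v = ρ^δ_q`, `TopEigGapCutoffPowDeriv`) is paid by the heat price of `Φ_q = ∫(λ₁⁺)^q`
   WITHOUT an error term: `∫ρ^δ_q ≤ (4/(q(q−1))) · heatDissipation Φ_q v`. Proof: at one level `ε`,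
   Danskin's formula `T_q = −∫qλ₁^{q−1}μ` (`TopEigHeatDanskin`), `∫ρ^ε_q = −2∫H_ε(λ₁)μ` (the flux
   `F^ε_{q,k} = H_ε(λ₁)∂ₖλ₁` is globally smooth on the class and `∫∂ₖF = 0`), and the UNIFORM weight error
   `0 ≤ λ₁^{q−1} − H_ε(λ₁) ≤ (2ε)^{q−1}` (`TopEigGapCutoffLow`) give `∫ρ^ε_q ≤ (2/q)T_q + 2(2ε)^{q−1}∫‖S(Δv)‖`;
   the two-level comparison `ρ^δ_q ≤ (2/(q−1))ρ^ε_q` (`4ε ≤ δ`) and `ε → 0⁺` remove the error. (Above `q = 2`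
   the tree lets `δ → 0` instead, with the error `4δ∫λ₁^{q−2}‖S(Δv)‖`, which is not available below `2`.)
2. **`exists_integral_norm_sq_le_topEigMoment_rpow`** (`6/5 ≤ q ≤ 2`): `∃ K₀ ≥ 0`, `∫‖u‖² ≤ K₀Φ_q(u)^{2/q}`
   for every smooth, divergence-free, zero-mean `u` — Sobolev–Poincaré at `(s, r) = (q, 2)` (legal iff
   `1/q − 1/3 ≤ 1/2 ⟺ q ≥ 6/5`; the literature seat's `Torus.exists_integral_rpow_le_gradient_of_hasZeroMean`,
   RRS 2016), Calderón–Zygmund `‖∇u‖_q ≤ K‖S‖_q` (`StrainCZ`), `|S| ≤ 6λ₁`; the floor-free half of the tree's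
   `exists_integral_norm_sq_mul_topEig_rpow_le_of_floor`.
NOT CLAIMED: anything about the node here (sequel); `q < 6/5` for the brick; Navier–Stokes regularity.

[ours]
FILING (prove seat g32, SLOT OWN-B2, LEAD (58g) INBOX l.5704): = staged `pub-nsfunc-prove/staged/g32-own/TopEigGapCutoffLowHeat.lean` 8bdcd10114404724; this line is the only addition.
-/

noncomputable section

open Filter Topology Matrix Finset MeasureTheory Set
open scoped ContDiff

namespace Summit.NavierStokesRegularity.FunctionalMining

open Literature.Analysis Literature.Analysis.FunctionSpaces Literature.Analysis.FunctionSpaces.Torus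
  SharpClass.DirectorForm Literature.Analysis.Matrix

namespace TopEig

variable {v : UnitAddTorus (Fin 3) → EuclideanSpace ℝ (Fin 3)}

/-! ## 1. The heat side below `q = 2`: `∫ρ^δ_q ≤ (4/(q(q−1))) T_q` at every fixed `δ > 0` -/

/-- At one level `ε > 0` (`1 < q ≤ 2`, top-gap class, `0 < η`): `ρ^ε_q` is integrable and
**`∫ρ^ε_q ≤ (2/q)T_q + 2(2ε)^{q−1}∫‖S(Δv)‖`** (Danskin `T_q = −∫qλ₁^{q−1}μ`, `∫ρ^ε_q = −2∫H_ε(λ₁)μ`,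
`0 ≤ λ₁^{q−1} − H_ε(λ₁) ≤ (2ε)^{q−1}`, `|μ| ≤ ‖S(Δv)‖`). [ours] -/
theorem integral_cutDensityPow_le_add_of_le_two (hv : Torus.IsSmooth v) (hdiv : Torus.IsDivFree v)
    {q : ℝ} (hq1 : 1 < q) (hq2 : q ≤ 2) {η : ℝ} (hη0 : 0 < η)
    (hgap : ∀ x : UnitAddTorus (Fin 3), torusStrainMidEig v x ≤ (1 - η) * torusStrainTopEig v x)
    {ε : ℝ} (hε : 0 < ε) :
    Integrable (cutDensityPow ε q v) volume ∧
      ∫ x, cutDensityPow ε q v x ≤ 2 / q * heatDissipation (torusTopEigMoment q) v +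
        2 * (2 * ε) ^ (q - 1) * ∫ x, ‖StrainL4.strainFlat (Torus.laplacian v) x‖ := by
  have hq1' : (1 : ℝ) ≤ q := hq1.le
  have hq0 : 0 < q := by linarith
  have hFs : ∀ k, Torus.IsSmooth (cutFluxPow ε q v k) := fun k =>
    isSmooth_cutFluxPow hv hdiv q hε hη0 hgap k
  have hl0 : ∀ x, 0 ≤ torusStrainTopEig v x := fun x => by
    rw [← lam_strainFlat]; exact lam_strainFlat_nonneg hv hdiv x
  have hlc : Continuous (torusStrainTopEig v) := continuous_torusStrainTopEig hv
  have hHc : Continuous fun x => cutPow ε q (torusStrainTopEig v x) := (continuous_cutPow hε q).comp hlc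
  have hH0 : ∀ x, 0 ≤ cutPow ε q (torusStrainTopEig v x) := fun x => cutPow_nonneg q (hl0 x)
  set μ : UnitAddTorus (Fin 3) → ℝ := fun x =>
    dirTopEig (StrainL4.strainFlat v x) (StrainL4.strainFlat (Torus.laplacian v) x) with hμdef
  set C : ℝ := ∫ x, ‖StrainL4.strainFlat (Torus.laplacian v) x‖ with hCdef
  set T : ℝ := heatDissipation (torusTopEigMoment q) v with hTdef
  have hT : T = -∫ x, q * torusStrainTopEig v x ^ (q - 1) * μ x := by
    rw [hTdef, heatDissipation_topEigMoment_eq_integral hq1' hv hdiv]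
  have hμm : AEStronglyMeasurable μ volume := by
    have h := aestronglyMeasurable_danskinDensity (q := 1) le_rfl hv hv.laplacian
    refine h.congr (ae_of_all _ fun x => ?_)
    dsimp only
    rw [show (1 : ℝ) - 1 = 0 by norm_num, Real.rpow_zero]
    ring
  have hμbd : ∀ x, |μ x| ≤ ‖StrainL4.strainFlat (Torus.laplacian v) x‖ := fun x =>
    abs_dirTopEig_le_norm _ _
  have hnc : Continuous fun x => ‖StrainL4.strainFlat (Torus.laplacian v) x‖ :=
    (StrainL4.continuous_strainFlat hv.laplacian).norm
  have hLmu : Integrable (fun x => q * torusStrainTopEig v x ^ (q - 1) * μ x) volume :=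
    integrable_danskinDensity hq1' hv hv.laplacian hdiv
  have hHμ : Integrable (fun x => cutPow ε q (torusStrainTopEig v x) * μ x) volume := by
    refine Integrable.mono' ((hHc.mul hnc).integrable_unitAddTorus) (hHc.aestronglyMeasurable.mul hμm)
      (ae_of_all _ fun x => ?_)
    rw [Real.norm_eq_abs, abs_mul, abs_of_nonneg (hH0 x)]
    exact mul_le_mul_of_nonneg_left (hμbd x) (hH0 x)
  have hdivF : ∀ k, Integrable (fun x => Torus.partialDeriv k (cutFluxPow ε q v k) x) volume := fun k =>
    ((hFs k).partialDeriv k).integrable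
  have hdivF0 : ∀ k, ∫ x, Torus.partialDeriv k (cutFluxPow ε q v k) x = 0 := fun k =>
    integral_partialDeriv_eq_zero_holds (d := Fin 3) (F := ℝ) (hFs k) k
  have hρint : Integrable (cutDensityPow ε q v) volume := by
    unfold cutDensityPow
    exact ((integrable_finsetSum _ fun k _ => hdivF k).sub hHμ).const_mul 2
  refine ⟨hρint, ?_⟩
  have hρeq : ∫ x, cutDensityPow ε q v x = -2 * ∫ x, cutPow ε q (torusStrainTopEig v x) * μ x := by
    unfold cutDensityPow
    rw [integral_const_mul, integral_sub (integrable_finsetSum _ fun k _ => hdivF k) hHμ,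
      integral_finsetSum _ fun k _ => hdivF k]
    simp only [hdivF0, Finset.sum_const_zero, zero_sub]
    ring
  -- the weight error, uniform below `q = 2`
  have hI : Integrable (fun x => 2 * (torusStrainTopEig v x ^ (q - 1) - cutPow ε q (torusStrainTopEig v x)) * μ x)
      volume := by
    refine ((hLmu.const_mul (2 / q)).sub (hHμ.const_mul 2)).congr (ae_of_all _ fun x => ?_)
    simp only [Pi.sub_apply]
    have e : 2 / q * q = 2 := by field_simp
    linear_combination (torusStrainTopEig v x ^ (q - 1) * μ x) * e
  have hbound : ∀ x, 2 * (torusStrainTopEig v x ^ (q - 1) - cutPow ε q (torusStrainTopEig v x)) * μ x ≤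
      2 * (2 * ε) ^ (q - 1) * ‖StrainL4.strainFlat (Torus.laplacian v) x‖ := by
    intro x
    obtain ⟨h1, -⟩ := rpow_sub_cutPow_mem_of_one_lt hε hq1 (hl0 x)
    have h2 := rpow_sub_cutPow_le_of_le_two hq1 hq2 hε (hl0 x)
    have h3 : μ x ≤ ‖StrainL4.strainFlat (Torus.laplacian v) x‖ := (le_abs_self _).trans (hμbd x)
    have h4 : 0 ≤ ‖StrainL4.strainFlat (Torus.laplacian v) x‖ := norm_nonneg _
    nlinarith
  have hI2 : Integrable (fun x => 2 * (2 * ε) ^ (q - 1) * ‖StrainL4.strainFlat (Torus.laplacian v) x‖) volume :=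
    (hnc.const_mul _).integrable_unitAddTorus
  have hle := integral_mono hI hI2 hbound
  have e1 : ∫ x, 2 * (torusStrainTopEig v x ^ (q - 1) - cutPow ε q (torusStrainTopEig v x)) * μ x =
      2 / q * (∫ x, q * torusStrainTopEig v x ^ (q - 1) * μ x) -
        2 * ∫ x, cutPow ε q (torusStrainTopEig v x) * μ x := by
    rw [← integral_const_mul, ← integral_const_mul, ← integral_sub (hLmu.const_mul _) (hHμ.const_mul 2)]
    refine integral_congr_ae (ae_of_all _ fun x => ?_)
    dsimp only
    have e : 2 / q * q = 2 := by field_simp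
    linear_combination (-(torusStrainTopEig v x ^ (q - 1) * μ x)) * e
  have e2 : ∫ x, 2 * (2 * ε) ^ (q - 1) * ‖StrainL4.strainFlat (Torus.laplacian v) x‖ =
      2 * (2 * ε) ^ (q - 1) * C := by rw [integral_const_mul]
  rw [e1, e2] at hle
  rw [hρeq, hT]
  linarith

/-- **THE HEAT SIDE BELOW `q = 2`, EXACT AT EVERY LEVEL.** For `v` smooth and divergence free on `T³` of
the top-gap class (`0 < η`), `1 < q ≤ 2` and every `δ > 0`:
**`∫ cutDensityPow δ q v ≤ (4/(q(q−1))) · heatDissipation Φ_q v`.**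
Proof: `ρ^δ_q ≤ (2/(q−1))ρ^ε_q` pointwise for `4ε ≤ δ` (`cutDensityPow_le_of_le_two`), the previous lemma at
level `ε`, and `ε → 0⁺`. [ours] -/
theorem integral_cutDensityPow_le_heat_of_le_two (hv : Torus.IsSmooth v) (hdiv : Torus.IsDivFree v)
    {q : ℝ} (hq1 : 1 < q) (hq2 : q ≤ 2) {η : ℝ} (hη0 : 0 < η)
    (hgap : ∀ x : UnitAddTorus (Fin 3), torusStrainMidEig v x ≤ (1 - η) * torusStrainTopEig v x)
    {δ : ℝ} (hδ : 0 < δ) :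
    ∫ x, cutDensityPow δ q v x ≤ 4 / (q * (q - 1)) * heatDissipation (torusTopEigMoment q) v := by
  have hq0 : 0 < q := by linarith
  have hq1' : 0 < q - 1 := by linarith
  set T : ℝ := heatDissipation (torusTopEigMoment q) v with hTdef
  set C : ℝ := ∫ x, ‖StrainL4.strainFlat (Torus.laplacian v) x‖ with hCdef
  obtain ⟨hρδ, -⟩ := integral_cutDensityPow_le_add_of_le_two hv hdiv hq1 hq2 hη0 hgap hδ
  -- for every `0 < ε ≤ δ/4`
  have hfam : ∀ ε : ℝ, 0 < ε → ε ≤ δ / 4 →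
      ∫ x, cutDensityPow δ q v x ≤ 2 / (q - 1) * (2 / q * T + 2 * (2 * ε) ^ (q - 1) * C) := by
    intro ε hε hεδ
    obtain ⟨hρε, hle⟩ := integral_cutDensityPow_le_add_of_le_two hv hdiv hq1 hq2 hη0 hgap hε
    have h4 : 4 * ε ≤ δ := by linarith
    have hmono : ∫ x, cutDensityPow δ q v x ≤ ∫ x, 2 / (q - 1) * cutDensityPow ε q v x :=
      integral_mono hρδ (hρε.const_mul _) fun x => cutDensityPow_le_of_le_two hv hdiv hq1 hq2 hε h4 hη0 hgap x
    rw [integral_const_mul] at hmono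
    exact hmono.trans (mul_le_mul_of_nonneg_left hle (by positivity))
  -- `ε → 0⁺`
  have hcont : Continuous fun ε : ℝ => 2 / (q - 1) * (2 / q * T + 2 * (2 * ε) ^ (q - 1) * C) :=
    continuous_const.mul (continuous_const.add
      ((continuous_const.mul ((continuous_const.mul continuous_id).rpow_const fun _ => Or.inr hq1'.le)).mul
        continuous_const))
  have hlim : Tendsto (fun ε : ℝ => 2 / (q - 1) * (2 / q * T + 2 * (2 * ε) ^ (q - 1) * C))
      (𝓝[>] 0) (𝓝 (2 / (q - 1) * (2 / q * T))) := by
    have h := hcont.tendsto 0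
    simp only [mul_zero, Real.zero_rpow hq1'.ne', zero_mul, add_zero] at h
    exact h.mono_left nhdsWithin_le_nhds
  have hev : ∀ᶠ ε in 𝓝[>] (0 : ℝ),
      ∫ x, cutDensityPow δ q v x ≤ 2 / (q - 1) * (2 / q * T + 2 * (2 * ε) ^ (q - 1) * C) := by
    filter_upwards [Ioc_mem_nhdsGT (show (0 : ℝ) < δ / 4 by positivity)] with ε hε
    exact hfam ε hε.1 hε.2
  have hmain : ∫ x, cutDensityPow δ q v x ≤ 2 / (q - 1) * (2 / q * T) := ge_of_tendsto hlim hev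
  have e : 2 / (q - 1) * (2 / q * T) = 4 / (q * (q - 1)) * T := by
    field_simp
    ring
  rw [e] at hmain
  exact hmain

/-! ## 2. The velocity brick at `(s, r) = (q, 2)`: `∫‖u‖² ≤ K₀ Φ_q^{2/q}` for `6/5 ≤ q ≤ 2` -/

/-- **THE VELOCITY BRICK.** For `6/5 ≤ q ≤ 2` there is `K₀ ≥ 0` such that for every smooth, divergence-free,
zero-mean `u` on `T³`: `∫‖u‖² ≤ K₀ · Φ_q(u)^{2/q}` (`‖u‖₂ ≤ C‖∇u‖_q` — Sobolev–Poincaré at `(s,r) = (q,2)`,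
`1/q − 1/3 ≤ 1/2 ⟺ q ≥ 6/5` —, `‖∇u‖_q ≤ K‖S‖_q` (Calderón–Zygmund), `|S| ≤ 6λ₁`). The floor-free half of
the tree's `exists_integral_norm_sq_mul_topEig_rpow_le_of_floor`. [ours] -/
theorem exists_integral_norm_sq_le_topEigMoment_rpow {q : ℝ} (hq : 6 / 5 ≤ q) (hq2 : q ≤ 2) :
    ∃ K₀ : ℝ, 0 ≤ K₀ ∧ ∀ (u : UnitAddTorus (Fin 3) → EuclideanSpace ℝ (Fin 3)), Torus.IsSmooth u →
      Torus.IsDivFree u → Torus.HasZeroMean u →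
        ∫ x, ‖u x‖ ^ 2 ≤ K₀ * torusTopEigMoment q u ^ (2 / q) := by
  have hq0 : 0 < q := by linarith
  have hq1 : 1 < q := by linarith
  have hq3 : q < 3 := by linarith
  have hsr : 1 / q - 1 / 3 ≤ 1 / (2 : ℝ) := by
    rw [div_sub_div _ _ hq0.ne' (by norm_num), div_le_div_iff₀ (by positivity) (by norm_num)]
    nlinarith
  obtain ⟨C, hC0, hC⟩ := Torus.exists_integral_rpow_le_gradient_of_hasZeroMean (d := Fin 3)
    (F' := EuclideanSpace ℝ (Fin 3)) (by simp) hq1.le hq3 (by norm_num : (0 : ℝ) < 2) hsr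
  obtain ⟨K, hK0, hK⟩ := StrainTensor.exists_gradLs_le_strainLs hq1
  refine ⟨(6 * C * K) ^ 2, by positivity, fun u hu hdiv hmean => ?_⟩
  have hF0 : 0 ≤ torusTopEigMoment q u := torusTopEigMoment_nonneg q u
  have hS : (∫ x, Real.sqrt (torusStrainSqAt u x) ^ q) ^ (1 / q) ≤ 6 * torusTopEigMoment q u ^ (1 / q) := by
    have h := rpow_integral_strain_rpow_le hu hdiv hq0
    have hJ : ∫ x, torusStrainTopEig u x ^ q = torusTopEigMoment q u := by
      rw [torusTopEigMoment_eq hu hdiv q]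
      exact integral_congr_ae (ae_of_all _ fun x => by show _ = lam _ ^ q; rw [lam_strainFlat])
    rw [hJ] at h
    exact h
  have hV : (∫ x, ‖u x‖ ^ (2 : ℝ)) ^ (1 / (2 : ℝ)) ≤ 6 * C * K * torusTopEigMoment q u ^ (1 / q) := by
    have ha := hC u hu hmean
    have hb := hK u hu hdiv
    calc (∫ x, ‖u x‖ ^ (2 : ℝ)) ^ (1 / (2 : ℝ))
        ≤ C * (∫ x, Real.sqrt (∑ j, ‖Torus.partialDeriv j u x‖ ^ 2) ^ q) ^ (1 / q) := ha
      _ ≤ C * (K * (6 * torusTopEigMoment q u ^ (1 / q))) := by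
          refine mul_le_mul_of_nonneg_left (hb.trans ?_) hC0
          exact mul_le_mul_of_nonneg_left hS hK0
      _ = 6 * C * K * torusTopEigMoment q u ^ (1 / q) := by ring
  have hI2 : 0 ≤ ∫ x, ‖u x‖ ^ (2 : ℝ) := integral_nonneg fun x => Real.rpow_nonneg (norm_nonneg _) _
  have e1 : ∫ x, ‖u x‖ ^ 2 = ((∫ x, ‖u x‖ ^ (2 : ℝ)) ^ (1 / (2 : ℝ))) ^ 2 := by
    rw [← Real.rpow_natCast, ← Real.rpow_mul hI2]
    norm_num
  have e2 : torusTopEigMoment q u ^ (2 / q) = (torusTopEigMoment q u ^ (1 / q)) ^ 2 := by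
    rw [← Real.rpow_natCast, ← Real.rpow_mul hF0]; congr 1; push_cast; ring
  rw [e1, e2, ← mul_pow]
  exact pow_le_pow_left₀ (Real.rpow_nonneg hI2 _) hV 2

end TopEig

end Summit.NavierStokesRegularity.FunctionalMining

end
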